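/-
Copyright (c) 2026 the pub-hodgecm-mathlib formalisation cell (harness21).  Prover seat hodgecm-mathlib-K2E1-p15 (g0), Track B ∕ K2-LIT «5Res», h413 = `stmt-HodgeConjecture-24833`,
line `K2_E1_TraceFormulaBeta`, route of record `HCCMUnconditional`; dealer K2E1-plan (g7) `hB` ruling 13:26:48Z ((β) now, (α) → K2E1-p12): the bridge from the per-BALL export
(α) `hαexp` (K2 bus 13:29Z bytes) to the per-POINT datum `hdat` of ★ p860603 `hB_of_perPoint_selfDual_truncatedFamily`, and the density of the good points.
-/
import Summits.HodgeConjecture.HodgeConjecture.Theorems.K2E1TruncationLevelChangeFamilyCMTwo            -- ★ p860571 (this seat): `exists_truncatedFamily_levelChange`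
import Summits.HodgeConjecture.HodgeConjecture.Theorems.K2E1SphericalEisensteinPoleExclusionCMThree  -- ★ p859741 (K2E1-p11): `countable_ball_diff_of_codiscrete`
import Summits.HodgeConjecture.HodgeConjecture.Theorems.K2E1ConvexDiffCountableConnected            -- ★ p859595 (K2E4-p11): `isPreconnected_convex_diff_of_countable`
import HarnessLib

/-!
# K2·E1 — `K2E1ChiEisensteinPerPointFamilyCMTwo`: FROM THE PER-BALL CONTINUED TRUNCATED FAMILIES (edition (α) of the M1 print) TO THE PER-POINT LEVEL-`T` DATUM OF THE `hB`
# LETTER (★ `K2E1ChiScatteringStripBoundM1CMTwo`), AND THE DENSITY OF THE GOOD POINTS IN THE HALF-STRIP (`U(1,1)_{L∕L⁺}`)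

Track B ∕ K2-LIT, crux h413 = `stmt-HodgeConjecture-24833`; cell `hodgecm-mathlib`, squad K2, ENGINE E1.  THEOREMS ONLY (no `def`, no `instance`, no notation, no named-fact hypothesis, no
`sorry`); lane `--kind proof --supports stmt-HodgeConjecture-24833 --as helper` (count-neutral).  Closes no socket.

WHAT.  INPUT (the (α) export, K2E1-p12 `K2E1ChiEisensteinM1FamilyExportCMTwo`, my 13:29Z bytes, skolemised): for `n ≥ n₀` an open co-discrete `U n ⊆ D_n = ball 0 (n+2)`, a level
`T₀ n ≥ 1` and `Fam n : ℂ → L²(𝔛)` holomorphic on `U n ∖ P` with `Fam n z =ᵐ quotFun (Λ^{T₀ n}(Ec z))` on the tube; the closed countable co-discrete `P`; (E1); and the continued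
constant-term band datum `w` of ★ p860571 on `Pᶜ` (M1: `w z = f_z^φ + Σ_j qc_j z • bV_j`).  OUTPUT: (§1) the topology of the ball domains `D₁^±(n) = (D^± ∩ D_n ∩ U n) ∖ P` as lemmas (the
blocks of ★ p859971 ∕ ★ p860229); (§2) **`exists_perPoint_truncatedFamily`** — at every GOOD point `z` (`Im z ≠ 0`, `½ < Re z`, `z ∉ P`, `z ∈ U n` for a ball `n ≥ max n₀ 2` containing it)
the datum `hdat` of ★ p860603 at ANY level `T ≥ 1`: `∃ D₁ O₁ O₂' Fam', open, preconnected, in one quadrant, boxes, z ∈ D₁ ⊆ Pᶜ, Fam' holomorphic on D₁, Fam' =ᵐ quotFun (Λ^T(Ec ·))` on the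
tube (★ p860571 level change; ED. 2 `exists_perPoint_truncatedFamily'` asks the local bound `hwloc` only on bands above height `1`); (§3) **`exists_seq_tendsto_of_countable`** — every point of the half-strip `{½ < Re ≤ σ₀, 1 ≤ |Im|}` is a limit of half-strip points avoiding any countable
set (the segment `z + δ(−1 + sign(Im z)·i)` stays in the half-strip; countable sets are Lebesgue-null), and `countable_bad` — the bad set `P ∪ ⋃_n (D_n ∖ U n)` is countable.

HONEST LABEL: HC_CM is proved only modulo the 7 printed citations (2 remaining named inputs: hLiu418 = `stmt-HodgeConjecture-24832`, h413 = `stmt-HodgeConjecture-24833`) until rung 0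
closes; this file asserts no named fact and closes no socket.

## References
* [MoeglinWaldspurger1995] C. Mœglin, J.-L. Waldspurger, *Spectral decomposition and Eisenstein series* (1995), IV.2.3, IV.3.12 (a).
* [BernsteinLapid2019] J. Bernstein, E. Lapid, *On the meromorphic continuation of Eisenstein series*, J. AMS 37 (2024), Thm 2.3, §4.
-/

set_option autoImplicit false
set_option linter.dupNamespace false  -- the mandated namespace repeats the summit's segment (`HodgeConjecture.HodgeConjecture`)

noncomputable section

open MeasureTheory MeasureTheory.Measure Set Filter Topology NumberField Metric
open scoped NNReal ENNReal
open Literature.NumberTheory.Automorphic Literature.NumberTheory.Automorphic.UnitaryGroup AdelicGroupData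
open Summit.HodgeConjecture.HodgeConjecture.Cruxes.H413.K2E1BorelEisensteinU
open Summit.HodgeConjecture.HodgeConjecture.Cruxes.H413.K2E1ConvexDiffCountableConnected (isPreconnected_convex_diff_of_countable)
open Summit.HodgeConjecture.HodgeConjecture.Cruxes.H413.K2E1SphericalEisensteinPoleExclusionCMThree (countable_ball_diff_of_codiscrete)
open Summit.HodgeConjecture.HodgeConjecture.Cruxes.H413.K2E1TruncationLevelChangeFamilyCMTwo (exists_truncatedFamily_levelChange)

namespace Summit.HodgeConjecture.HodgeConjecture.Cruxes.H413.K2E1ChiEisensteinPerPointFamilyCMTwo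

/-! ## §1 Topology of the ball domains -/

/-- **THE UPPER BALL DOMAIN `D₁⁺(n) = (D⁺ ∩ D_n ∩ U) ∖ P` IS OPEN, PRECONNECTED AND CARRIES TWO SUB-TUBE BOXES** (`2 ≤ n`, `U` open co-discrete in `D_n`, `P` closed countable) — the topology block of ★ `chiPoleExclusion_bounds_cm_two` as a lemma. [cite: MoeglinWaldspurger1995, IV.3.12 (a)] -/
theorem upperDomain_topology (n : ℕ) (hn : 2 ≤ n) {U : Set ℂ} (hUo : IsOpen U) (hUcod : ∀ z₀ ∈ Metric.ball (0 : ℂ) (n + 2), ∀ᶠ s in 𝓝[≠] z₀, s ∈ U)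
    {P : Set ℂ} (hPc : IsClosed P) (hPcount : P.Countable) :
    IsOpen ((({z : ℂ | 1 / 2 < z.re ∧ 0 < z.im} ∩ Metric.ball (0 : ℂ) (n + 2) ∩ U) \ P)) ∧ IsPreconnected ((({z : ℂ | 1 / 2 < z.re ∧ 0 < z.im} ∩ Metric.ball (0 : ℂ) (n + 2) ∩ U) \ P)) ∧
      ∃ O₁ O₂' : Set ℂ, IsOpen O₁ ∧ O₁.Nonempty ∧ O₁ ⊆ (({z : ℂ | 1 / 2 < z.re ∧ 0 < z.im} ∩ Metric.ball (0 : ℂ) (n + 2) ∩ U) \ P) ∧ IsOpen O₂' ∧ O₂'.Nonempty ∧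
        O₂' ⊆ (({z : ℂ | 1 / 2 < z.re ∧ 0 < z.im} ∩ Metric.ball (0 : ℂ) (n + 2) ∩ U) \ P) ∧ ∀ z ∈ O₁, ∀ z' ∈ O₂', 1 < z'.re ∧ z'.re < z.re := by
  set D₁ : Set ℂ := ({z : ℂ | 1 / 2 < z.re ∧ 0 < z.im} ∩ Metric.ball (0 : ℂ) (n + 2) ∩ U) \ P with hD₁def
  set C : Set ℂ := {z : ℂ | 1 / 2 < z.re ∧ 0 < z.im} ∩ Metric.ball (0 : ℂ) (n + 2) with hCdef
  set S : Set ℂ := (Metric.ball (0 : ℂ) (n + 2) \ U) ∪ P with hSdef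
  have hQo : IsOpen {z : ℂ | 1 / 2 < z.re ∧ 0 < z.im} := (isOpen_lt continuous_const Complex.continuous_re).inter (isOpen_lt continuous_const Complex.continuous_im)
  have hCo : IsOpen C := hQo.inter Metric.isOpen_ball
  have hCc : Convex ℝ C := ((convex_halfSpace_re_gt (1 / 2)).inter (convex_halfSpace_im_gt 0)).inter (convex_ball (0 : ℂ) (n + 2))
  have hSc : S.Countable := (countable_ball_diff_of_codiscrete hUcod).union hPcount
  have hDCS : D₁ = C \ S := by
    ext z
    simp only [hD₁def, hCdef, hSdef, Set.mem_sdiff, Set.mem_inter_iff, Set.mem_union, not_or, not_and, not_not]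
    constructor
    · rintro ⟨⟨⟨hq, hb⟩, hU⟩, hP⟩
      exact ⟨⟨hq, hb⟩, fun _ => hU, hP⟩
    · rintro ⟨⟨hq, hb⟩, hU, hP⟩
      exact ⟨⟨⟨hq, hb⟩, hU hb⟩, hP⟩
  have hD₁o : IsOpen D₁ := (hCo.inter hUo).sdiff hPc
  have hD₁c : IsPreconnected D₁ := by
    rw [hDCS]
    exact isPreconnected_convex_diff_of_countable Literature.Topology.Euclidean.one_lt_rank_real_complex hCc hCo hSc
  -- the boxes
  have hn' : (2 : ℝ) ≤ n := by exact_mod_cast hn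
  have hdense : Dense Sᶜ := hSc.dense_compl ℝ
  have hbox : ∀ (a₁ b₁ : ℝ) (w : ℂ), a₁ < w.re → w.re < b₁ → 0 < w.im → w.im < 1 → 1 / 2 < w.re → ‖w‖ < n + 2 →
      IsOpen (D₁ ∩ {z : ℂ | (a₁ < z.re ∧ z.re < b₁) ∧ (0 < z.im ∧ z.im < 1)}) ∧ (D₁ ∩ {z : ℂ | (a₁ < z.re ∧ z.re < b₁) ∧ (0 < z.im ∧ z.im < 1)}).Nonempty := by
    intro a₁ b₁ w h1 h2 h3 h4 h5 h6
    have hBo : IsOpen {z : ℂ | (a₁ < z.re ∧ z.re < b₁) ∧ (0 < z.im ∧ z.im < 1)} :=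
      ((isOpen_lt continuous_const Complex.continuous_re).inter (isOpen_lt Complex.continuous_re continuous_const)).inter
        ((isOpen_lt continuous_const Complex.continuous_im).inter (isOpen_lt Complex.continuous_im continuous_const))
    refine ⟨hD₁o.inter hBo, ?_⟩
    have hwC : w ∈ C ∩ {z : ℂ | (a₁ < z.re ∧ z.re < b₁) ∧ (0 < z.im ∧ z.im < 1)} := ⟨⟨⟨h5, h3⟩, mem_ball_zero_iff.2 h6⟩, ⟨h1, h2⟩, ⟨h3, h4⟩⟩
    obtain ⟨z, ⟨hzC, hzB⟩, hzS⟩ := hdense.inter_open_nonempty _ (hCo.inter hBo) ⟨w, hwC⟩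
    refine ⟨z, ⟨?_, hzB⟩⟩
    rw [hDCS]
    exact ⟨hzC, hzS⟩
  have hw₁ : ‖(⟨31 / 10, 1 / 10⟩ : ℂ)‖ < n + 2 :=
    lt_of_le_of_lt (Complex.norm_le_abs_re_add_abs_im _) (by norm_num [abs_of_pos]; linarith)
  have hw₂ : ‖(⟨11 / 10, 1 / 10⟩ : ℂ)‖ < n + 2 :=
    lt_of_le_of_lt (Complex.norm_le_abs_re_add_abs_im _) (by norm_num [abs_of_pos]; linarith)
  obtain ⟨hO₁o, hO₁ne⟩ := hbox 3 4 ⟨31 / 10, 1 / 10⟩ (by norm_num) (by norm_num) (by norm_num) (by norm_num) (by norm_num) hw₁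
  obtain ⟨hO₂o, hO₂ne⟩ := hbox 1 2 ⟨11 / 10, 1 / 10⟩ (by norm_num) (by norm_num) (by norm_num) (by norm_num) (by norm_num) hw₂
  have hsep : ∀ z ∈ D₁ ∩ {z : ℂ | (3 < z.re ∧ z.re < 4) ∧ (0 < z.im ∧ z.im < 1)}, ∀ z' ∈ D₁ ∩ {z : ℂ | (1 < z.re ∧ z.re < 2) ∧ (0 < z.im ∧ z.im < 1)}, 1 < z'.re ∧ z'.re < z.re :=
    fun z hz z' hz' => ⟨hz'.2.1.1, by linarith [hz'.2.1.2, hz.2.1.1]⟩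
  exact ⟨hD₁o, hD₁c, _, _, hO₁o, hO₁ne, Set.inter_subset_left, hO₂o, hO₂ne, Set.inter_subset_left, hsep⟩

/-- **THE LOWER BALL DOMAIN `D₁⁻(n) = (D⁻ ∩ D_n ∩ U) ∖ P`**: open, preconnected, two sub-tube boxes (the topology block of ★ `chiPoleExclusion_bounds_lower_cm_two`). [cite: MoeglinWaldspurger1995, IV.3.12 (a)] -/
theorem lowerDomain_topology (n : ℕ) (hn : 2 ≤ n) {U : Set ℂ} (hUo : IsOpen U) (hUcod : ∀ z₀ ∈ Metric.ball (0 : ℂ) (n + 2), ∀ᶠ s in 𝓝[≠] z₀, s ∈ U)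
    {P : Set ℂ} (hPc : IsClosed P) (hPcount : P.Countable) :
    IsOpen ((({z : ℂ | 1 / 2 < z.re ∧ z.im < 0} ∩ Metric.ball (0 : ℂ) (n + 2) ∩ U) \ P)) ∧ IsPreconnected ((({z : ℂ | 1 / 2 < z.re ∧ z.im < 0} ∩ Metric.ball (0 : ℂ) (n + 2) ∩ U) \ P)) ∧
      ∃ O₁ O₂' : Set ℂ, IsOpen O₁ ∧ O₁.Nonempty ∧ O₁ ⊆ (({z : ℂ | 1 / 2 < z.re ∧ z.im < 0} ∩ Metric.ball (0 : ℂ) (n + 2) ∩ U) \ P) ∧ IsOpen O₂' ∧ O₂'.Nonempty ∧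
        O₂' ⊆ (({z : ℂ | 1 / 2 < z.re ∧ z.im < 0} ∩ Metric.ball (0 : ℂ) (n + 2) ∩ U) \ P) ∧ ∀ z ∈ O₁, ∀ z' ∈ O₂', 1 < z'.re ∧ z'.re < z.re := by
  set D₁ : Set ℂ := ({z : ℂ | 1 / 2 < z.re ∧ z.im < 0} ∩ Metric.ball (0 : ℂ) (n + 2) ∩ U) \ P with hD₁def
  set C : Set ℂ := {z : ℂ | 1 / 2 < z.re ∧ z.im < 0} ∩ Metric.ball (0 : ℂ) (n + 2) with hCdef
  set S : Set ℂ := (Metric.ball (0 : ℂ) (n + 2) \ U) ∪ P with hSdef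
  have hQo : IsOpen {z : ℂ | 1 / 2 < z.re ∧ z.im < 0} := (isOpen_lt continuous_const Complex.continuous_re).inter (isOpen_lt Complex.continuous_im continuous_const)
  have hCo : IsOpen C := hQo.inter Metric.isOpen_ball
  have hCc : Convex ℝ C := ((convex_halfSpace_re_gt (1 / 2)).inter (convex_halfSpace_im_lt 0)).inter (convex_ball (0 : ℂ) (n + 2))
  have hSc : S.Countable := (countable_ball_diff_of_codiscrete hUcod).union hPcount
  have hDCS : D₁ = C \ S := by
    ext z
    simp only [hD₁def, hCdef, hSdef, Set.mem_sdiff, Set.mem_inter_iff, Set.mem_union, not_or, not_and, not_not]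
    constructor
    · rintro ⟨⟨⟨hq, hb⟩, hU⟩, hP⟩
      exact ⟨⟨hq, hb⟩, fun _ => hU, hP⟩
    · rintro ⟨⟨hq, hb⟩, hU, hP⟩
      exact ⟨⟨⟨hq, hb⟩, hU hb⟩, hP⟩
  have hD₁o : IsOpen D₁ := (hCo.inter hUo).sdiff hPc
  have hD₁c : IsPreconnected D₁ := by
    rw [hDCS]
    exact isPreconnected_convex_diff_of_countable Literature.Topology.Euclidean.one_lt_rank_real_complex hCc hCo hSc
  -- the boxes
  have hn' : (2 : ℝ) ≤ n := by exact_mod_cast hn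
  have hdense : Dense Sᶜ := hSc.dense_compl ℝ
  have hbox : ∀ (a₁ b₁ : ℝ) (w : ℂ), a₁ < w.re → w.re < b₁ → -1 < w.im → w.im < 0 → 1 / 2 < w.re → ‖w‖ < n + 2 →
      IsOpen (D₁ ∩ {z : ℂ | (a₁ < z.re ∧ z.re < b₁) ∧ (-1 < z.im ∧ z.im < 0)}) ∧ (D₁ ∩ {z : ℂ | (a₁ < z.re ∧ z.re < b₁) ∧ (-1 < z.im ∧ z.im < 0)}).Nonempty := by
    intro a₁ b₁ w h1 h2 h3 h4 h5 h6
    have hBo : IsOpen {z : ℂ | (a₁ < z.re ∧ z.re < b₁) ∧ (-1 < z.im ∧ z.im < 0)} :=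
      ((isOpen_lt continuous_const Complex.continuous_re).inter (isOpen_lt Complex.continuous_re continuous_const)).inter
        ((isOpen_lt continuous_const Complex.continuous_im).inter (isOpen_lt Complex.continuous_im continuous_const))
    refine ⟨hD₁o.inter hBo, ?_⟩
    have hwC : w ∈ C ∩ {z : ℂ | (a₁ < z.re ∧ z.re < b₁) ∧ (-1 < z.im ∧ z.im < 0)} := ⟨⟨⟨h5, h4⟩, mem_ball_zero_iff.2 h6⟩, ⟨h1, h2⟩, ⟨h3, h4⟩⟩
    obtain ⟨z, ⟨hzC, hzB⟩, hzS⟩ := hdense.inter_open_nonempty _ (hCo.inter hBo) ⟨w, hwC⟩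
    refine ⟨z, ⟨?_, hzB⟩⟩
    rw [hDCS]
    exact ⟨hzC, hzS⟩
  have hw₁ : ‖(⟨31 / 10, -(1 / 10)⟩ : ℂ)‖ < n + 2 :=
    lt_of_le_of_lt (Complex.norm_le_abs_re_add_abs_im _) (by norm_num [abs_of_pos, abs_of_neg]; linarith)
  have hw₂ : ‖(⟨11 / 10, -(1 / 10)⟩ : ℂ)‖ < n + 2 :=
    lt_of_le_of_lt (Complex.norm_le_abs_re_add_abs_im _) (by norm_num [abs_of_pos, abs_of_neg]; linarith)
  obtain ⟨hO₁o, hO₁ne⟩ := hbox 3 4 ⟨31 / 10, -(1 / 10)⟩ (by norm_num) (by norm_num) (by norm_num) (by norm_num) (by norm_num) hw₁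
  obtain ⟨hO₂o, hO₂ne⟩ := hbox 1 2 ⟨11 / 10, -(1 / 10)⟩ (by norm_num) (by norm_num) (by norm_num) (by norm_num) (by norm_num) hw₂
  have hsep : ∀ z ∈ D₁ ∩ {z : ℂ | (3 < z.re ∧ z.re < 4) ∧ (-1 < z.im ∧ z.im < 0)}, ∀ z' ∈ D₁ ∩ {z : ℂ | (1 < z.re ∧ z.re < 2) ∧ (-1 < z.im ∧ z.im < 0)}, 1 < z'.re ∧ z'.re < z.re :=
    fun z hz z' hz' => ⟨hz'.2.1.1, by linarith [hz'.2.1.2, hz.2.1.1]⟩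
  exact ⟨hD₁o, hD₁c, _, _, hO₁o, hO₁ne, Set.inter_subset_left, hO₂o, hO₂ne, Set.inter_subset_left, hsep⟩

/-! ## §2 The per-point level-`T` family -/

section CM

variable (L : Type) [Field L] [NumberField L] [IsCMField L]
  [MeasurableSpace (quasiSplit (↥(maximalRealSubfield L)) L (IsCMField.complexConj L) 2).Adelic] [BorelSpace (quasiSplit (↥(maximalRealSubfield L)) L (IsCMField.complexConj L) 2).Adelic]

/-- **THE PER-POINT DATUM OF ★ `hB_of_perPoint_selfDual_truncatedFamily` FROM THE PER-BALL EXPORT (α)** (module docstring §2): at a good point `z` (`½ < Re z`, `Im z ≠ 0`, `z ∉ P`, `z ∈ U n`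
for a ball `n ≥ max n₀ 2` containing `z`), for every level `T ≥ 1`, a domain `D₁ ∋ z` in one quadrant (open, preconnected, two sub-tube boxes, `D₁ ⊆ Pᶜ`) and a family `Fam'` holomorphic on
`D₁` with `Fam' w =ᵐ quotFun (Λ^T(Ec w))` on the tube part (★ p860571 `exists_truncatedFamily_levelChange` on `D₁ ⊆ U n ∖ P` with the band datum `w`).
[cite: MoeglinWaldspurger1995, IV.2.3, IV.3.12 (a)] [cite: BernsteinLapid2019, Thm 2.3, §4] -/
theorem exists_perPoint_truncatedFamily
    (μ : Measure (quasiSplit (↥(maximalRealSubfield L)) L (IsCMField.complexConj L) 2).automorphicQuotient) [IsFiniteMeasure μ]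
    (ν : Measure ↥(adelicUnipotent (↥(maximalRealSubfield L)) L (IsCMField.complexConj L) 2)) (𝓕 : Set ↥(adelicUnipotent (↥(maximalRealSubfield L)) L (IsCMField.complexConj L) 2))
    {T : ℝ≥0} (hT : 1 ≤ T)
    (φ : (quasiSplit (↥(maximalRealSubfield L)) L (IsCMField.complexConj L) 2).Adelic → ℂ)
    (Ec : ℂ → (quasiSplit (↥(maximalRealSubfield L)) L (IsCMField.complexConj L) 2).Adelic → ℂ) (hE1 : ∀ z : ℂ, 1 < z.re → Ec z = eisensteinSeriesU (flatSectionU φ z))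
    {P : Set ℂ} (hPc : IsClosed P) (hPcount : P.Countable)
    -- the per-ball export (α), skolemised
    (n₀ : ℕ) (U : ℕ → Set ℂ) (T₀ : ℕ → ℝ≥0) (Fam : ℕ → ℂ → Lp ℂ 2 μ)
    (hUo : ∀ n, n₀ ≤ n → IsOpen (U n)) (hUcod : ∀ n, n₀ ≤ n → ∀ z₀ ∈ Metric.ball (0 : ℂ) (n + 2), ∀ᶠ s in 𝓝[≠] z₀, s ∈ U n)
    (hT₀ : ∀ n, n₀ ≤ n → 1 ≤ T₀ n) (hFd : ∀ n, n₀ ≤ n → DifferentiableOn ℂ (Fam n) (U n \ P))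
    (hFtube : ∀ n, n₀ ≤ n → ∀ z ∈ U n \ P, 1 < z.re → ((Fam n z : Lp ℂ 2 μ) : (quasiSplit (↥(maximalRealSubfield L)) L (IsCMField.complexConj L) 2).automorphicQuotient → ℂ) =ᵐ[μ]
      (quasiSplit (↥(maximalRealSubfield L)) L (IsCMField.complexConj L) 2).quotFun (truncation ν 𝓕 (T₀ n) (Ec z)))
    -- the continued constant-term band datum on `Pᶜ`
    (w : ℂ → (quasiSplit (↥(maximalRealSubfield L)) L (IsCMField.complexConj L) 2).Adelic → ℂ)
    (hwB : ∀ z : ℂ, z ∉ P → ∀ β ∈ arithmeticBorel (↥(maximalRealSubfield L)) L (IsCMField.complexConj L) 2, ∀ g, w z ((β : (quasiSplit (↥(maximalRealSubfield L)) L (IsCMField.complexConj L) 2).Adelic) * g) = w z g)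
    (hwc : ∀ z : ℂ, z ∉ P → Continuous (w z))
    (hwd : ∀ g, DifferentiableOn ℂ (fun z => w z g) Pᶜ)
    (hwloc : ∀ z₀ : ℂ, z₀ ∉ P → ∀ lo hi : ℝ≥0, ∃ r > 0, Metric.ball z₀ r ⊆ Pᶜ ∧ ∃ M : ℝ, ∀ z ∈ Metric.ball z₀ r, ∀ g, lo < borelHeight g → borelHeight g ≤ hi → ‖w z g‖ ≤ M)
    (hCT : ∀ z : ℂ, z ∉ P → 1 < z.re → ∀ g, borelConstantTerm ν 𝓕 (eisensteinSeriesU (flatSectionU φ z)) g = w z g)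
    -- the good point
    {z : ℂ} (hz₁ : 1 / 2 < z.re) (hzim : z.im ≠ 0) (hzP : z ∉ P) {n : ℕ} (hn₀ : n₀ ≤ n) (hn2 : 2 ≤ n) (hzn : z ∈ Metric.ball (0 : ℂ) (n + 2)) (hzU : z ∈ U n) :
    ∃ (D₁ O₁ O₂' : Set ℂ) (Fam' : ℂ → Lp ℂ 2 μ), IsOpen D₁ ∧ IsPreconnected D₁ ∧
      (D₁ ⊆ {z : ℂ | 1 / 2 < z.re ∧ 0 < z.im} ∨ D₁ ⊆ {z : ℂ | 1 / 2 < z.re ∧ z.im < 0}) ∧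
      IsOpen O₁ ∧ O₁.Nonempty ∧ O₁ ⊆ D₁ ∧ IsOpen O₂' ∧ O₂'.Nonempty ∧ O₂' ⊆ D₁ ∧ (∀ w ∈ O₁, ∀ w' ∈ O₂', 1 < w'.re ∧ w'.re < w.re) ∧ z ∈ D₁ ∧ D₁ ⊆ Pᶜ ∧
      DifferentiableOn ℂ Fam' D₁ ∧
      ∀ w' ∈ D₁, 1 < w'.re → ((Fam' w' : Lp ℂ 2 μ) : (quasiSplit (↥(maximalRealSubfield L)) L (IsCMField.complexConj L) 2).automorphicQuotient → ℂ) =ᵐ[μ]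
        (quasiSplit (↥(maximalRealSubfield L)) L (IsCMField.complexConj L) 2).quotFun (truncation ν 𝓕 T (Ec w')) := by
  -- the level change on any OPEN `D₁ ⊆ U n ∖ P`
  have hLC : ∀ D₁ : Set ℂ, IsOpen D₁ → D₁ ⊆ U n \ P → ∃ Fam' : ℂ → Lp ℂ 2 μ, DifferentiableOn ℂ Fam' D₁ ∧
      ∀ w' ∈ D₁, 1 < w'.re → ((Fam' w' : Lp ℂ 2 μ) : (quasiSplit (↥(maximalRealSubfield L)) L (IsCMField.complexConj L) 2).automorphicQuotient → ℂ) =ᵐ[μ]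
        (quasiSplit (↥(maximalRealSubfield L)) L (IsCMField.complexConj L) 2).quotFun (truncation ν 𝓕 T (Ec w')) := by
    intro D₁ hD₁o hD₁
    have hDP : ∀ z ∈ D₁, z ∉ P := fun z hz => (hD₁ hz).2
    refine exists_truncatedFamily_levelChange L μ ν 𝓕 (hT₀ n hn₀) hT φ Ec hE1 w (fun z hz => hwB z (hDP z hz)) (fun z hz => hwc z (hDP z hz))
      (fun g _ _ => (hwd g).mono fun z hz => hDP z hz) (fun z₀ hz₀ => ?_) (fun z hz hz1 g _ _ => hCT z (hDP z hz) hz1 g) (Fam n) ((hFd n hn₀).mono hD₁)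
      (fun z hz hz1 => hFtube n hn₀ z (hD₁ hz) hz1)
    obtain ⟨r, hr, -, M, hM⟩ := hwloc z₀ (hDP z₀ hz₀) (min (T₀ n) T) (max (T₀ n) T)
    obtain ⟨r₁, hr₁, hr₁D⟩ := Metric.isOpen_iff.1 hD₁o z₀ hz₀
    exact ⟨min r r₁, lt_min hr hr₁, (Metric.ball_subset_ball (min_le_right _ _)).trans hr₁D, M,
      fun z hz g h1 h2 => hM z (Metric.ball_subset_ball (min_le_left _ _) hz) g h1 h2⟩
  rcases lt_or_gt_of_ne hzim with hneg | hpos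
  · -- the lower quadrant
    obtain ⟨hD₁o, hD₁c, O₁, O₂', hO₁, hO₁ne, hO₁D, hO₂', hO₂'ne, hO₂'D, hsep⟩ := lowerDomain_topology n hn2 (hUo n hn₀) (hUcod n hn₀) hPc hPcount
    have hsub : (({z : ℂ | 1 / 2 < z.re ∧ z.im < 0} ∩ Metric.ball (0 : ℂ) (n + 2) ∩ U n) \ P) ⊆ U n \ P := fun x hx => ⟨hx.1.2, hx.2⟩
    obtain ⟨Fam', hFd', hFt'⟩ := hLC _ hD₁o hsub
    exact ⟨_, O₁, O₂', Fam', hD₁o, hD₁c, Or.inr (fun x hx => hx.1.1.1), hO₁, hO₁ne, hO₁D, hO₂', hO₂'ne, hO₂'D, hsep, ⟨⟨⟨⟨hz₁, hneg⟩, hzn⟩, hzU⟩, hzP⟩,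
      fun x hx => hx.2, hFd', hFt'⟩
  · -- the upper quadrant
    obtain ⟨hD₁o, hD₁c, O₁, O₂', hO₁, hO₁ne, hO₁D, hO₂', hO₂'ne, hO₂'D, hsep⟩ := upperDomain_topology n hn2 (hUo n hn₀) (hUcod n hn₀) hPc hPcount
    have hsub : (({z : ℂ | 1 / 2 < z.re ∧ 0 < z.im} ∩ Metric.ball (0 : ℂ) (n + 2) ∩ U n) \ P) ⊆ U n \ P := fun x hx => ⟨hx.1.2, hx.2⟩
    obtain ⟨Fam', hFd', hFt'⟩ := hLC _ hD₁o hsub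
    exact ⟨_, O₁, O₂', Fam', hD₁o, hD₁c, Or.inl (fun x hx => hx.1.1.1), hO₁, hO₁ne, hO₁D, hO₂', hO₂'ne, hO₂'D, hsep, ⟨⟨⟨⟨hz₁, hpos⟩, hzn⟩, hzU⟩, hzP⟩,
      fun x hx => hx.2, hFd', hFt'⟩

/-- **ED. 2 OF THE PER-POINT DATUM — `hwloc` ONLY ON BANDS ABOVE HEIGHT `1`** (`1 ≤ lo`; the only bands ever used are `(min T₀ T, max T₀ T]` with `T₀, T ≥ 1`, and the M1 band datum
`f_z^φ + Σ_j qc_j z·bV_j` is locally bounded only on such bands).  Same conclusion as `exists_perPoint_truncatedFamily` at a good point `z` (`½ < Re z`, `Im z ≠ 0`, `z ∉ P`, `z ∈ U n`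
for a ball `n ≥ max n₀ 2` containing `z`), for every level `T ≥ 1`, a domain `D₁ ∋ z` in one quadrant (open, preconnected, two sub-tube boxes, `D₁ ⊆ Pᶜ`) and a family `Fam'` holomorphic on
`D₁` with `Fam' w =ᵐ quotFun (Λ^T(Ec w))` on the tube part (★ p860571 `exists_truncatedFamily_levelChange` on `D₁ ⊆ U n ∖ P` with the band datum `w`).
[cite: MoeglinWaldspurger1995, IV.2.3, IV.3.12 (a)] [cite: BernsteinLapid2019, Thm 2.3, §4] -/
theorem exists_perPoint_truncatedFamily'
    (μ : Measure (quasiSplit (↥(maximalRealSubfield L)) L (IsCMField.complexConj L) 2).automorphicQuotient) [IsFiniteMeasure μ]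
    (ν : Measure ↥(adelicUnipotent (↥(maximalRealSubfield L)) L (IsCMField.complexConj L) 2)) (𝓕 : Set ↥(adelicUnipotent (↥(maximalRealSubfield L)) L (IsCMField.complexConj L) 2))
    {T : ℝ≥0} (hT : 1 ≤ T)
    (φ : (quasiSplit (↥(maximalRealSubfield L)) L (IsCMField.complexConj L) 2).Adelic → ℂ)
    (Ec : ℂ → (quasiSplit (↥(maximalRealSubfield L)) L (IsCMField.complexConj L) 2).Adelic → ℂ) (hE1 : ∀ z : ℂ, 1 < z.re → Ec z = eisensteinSeriesU (flatSectionU φ z))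
    {P : Set ℂ} (hPc : IsClosed P) (hPcount : P.Countable)
    -- the per-ball export (α), skolemised
    (n₀ : ℕ) (U : ℕ → Set ℂ) (T₀ : ℕ → ℝ≥0) (Fam : ℕ → ℂ → Lp ℂ 2 μ)
    (hUo : ∀ n, n₀ ≤ n → IsOpen (U n)) (hUcod : ∀ n, n₀ ≤ n → ∀ z₀ ∈ Metric.ball (0 : ℂ) (n + 2), ∀ᶠ s in 𝓝[≠] z₀, s ∈ U n)
    (hT₀ : ∀ n, n₀ ≤ n → 1 ≤ T₀ n) (hFd : ∀ n, n₀ ≤ n → DifferentiableOn ℂ (Fam n) (U n \ P))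
    (hFtube : ∀ n, n₀ ≤ n → ∀ z ∈ U n \ P, 1 < z.re → ((Fam n z : Lp ℂ 2 μ) : (quasiSplit (↥(maximalRealSubfield L)) L (IsCMField.complexConj L) 2).automorphicQuotient → ℂ) =ᵐ[μ]
      (quasiSplit (↥(maximalRealSubfield L)) L (IsCMField.complexConj L) 2).quotFun (truncation ν 𝓕 (T₀ n) (Ec z)))
    -- the continued constant-term band datum on `Pᶜ`
    (w : ℂ → (quasiSplit (↥(maximalRealSubfield L)) L (IsCMField.complexConj L) 2).Adelic → ℂ)
    (hwB : ∀ z : ℂ, z ∉ P → ∀ β ∈ arithmeticBorel (↥(maximalRealSubfield L)) L (IsCMField.complexConj L) 2, ∀ g, w z ((β : (quasiSplit (↥(maximalRealSubfield L)) L (IsCMField.complexConj L) 2).Adelic) * g) = w z g)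
    (hwc : ∀ z : ℂ, z ∉ P → Continuous (w z))
    (hwd : ∀ g, DifferentiableOn ℂ (fun z => w z g) Pᶜ)
    (hwloc : ∀ z₀ : ℂ, z₀ ∉ P → ∀ lo hi : ℝ≥0, 1 ≤ lo → ∃ r > 0, Metric.ball z₀ r ⊆ Pᶜ ∧ ∃ M : ℝ, ∀ z ∈ Metric.ball z₀ r, ∀ g, lo < borelHeight g → borelHeight g ≤ hi → ‖w z g‖ ≤ M)
    (hCT : ∀ z : ℂ, z ∉ P → 1 < z.re → ∀ g, borelConstantTerm ν 𝓕 (eisensteinSeriesU (flatSectionU φ z)) g = w z g)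
    -- the good point
    {z : ℂ} (hz₁ : 1 / 2 < z.re) (hzim : z.im ≠ 0) (hzP : z ∉ P) {n : ℕ} (hn₀ : n₀ ≤ n) (hn2 : 2 ≤ n) (hzn : z ∈ Metric.ball (0 : ℂ) (n + 2)) (hzU : z ∈ U n) :
    ∃ (D₁ O₁ O₂' : Set ℂ) (Fam' : ℂ → Lp ℂ 2 μ), IsOpen D₁ ∧ IsPreconnected D₁ ∧
      (D₁ ⊆ {z : ℂ | 1 / 2 < z.re ∧ 0 < z.im} ∨ D₁ ⊆ {z : ℂ | 1 / 2 < z.re ∧ z.im < 0}) ∧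
      IsOpen O₁ ∧ O₁.Nonempty ∧ O₁ ⊆ D₁ ∧ IsOpen O₂' ∧ O₂'.Nonempty ∧ O₂' ⊆ D₁ ∧ (∀ w ∈ O₁, ∀ w' ∈ O₂', 1 < w'.re ∧ w'.re < w.re) ∧ z ∈ D₁ ∧ D₁ ⊆ Pᶜ ∧
      DifferentiableOn ℂ Fam' D₁ ∧
      ∀ w' ∈ D₁, 1 < w'.re → ((Fam' w' : Lp ℂ 2 μ) : (quasiSplit (↥(maximalRealSubfield L)) L (IsCMField.complexConj L) 2).automorphicQuotient → ℂ) =ᵐ[μ]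
        (quasiSplit (↥(maximalRealSubfield L)) L (IsCMField.complexConj L) 2).quotFun (truncation ν 𝓕 T (Ec w')) := by
  -- the level change on any OPEN `D₁ ⊆ U n ∖ P`
  have hLC : ∀ D₁ : Set ℂ, IsOpen D₁ → D₁ ⊆ U n \ P → ∃ Fam' : ℂ → Lp ℂ 2 μ, DifferentiableOn ℂ Fam' D₁ ∧
      ∀ w' ∈ D₁, 1 < w'.re → ((Fam' w' : Lp ℂ 2 μ) : (quasiSplit (↥(maximalRealSubfield L)) L (IsCMField.complexConj L) 2).automorphicQuotient → ℂ) =ᵐ[μ]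
        (quasiSplit (↥(maximalRealSubfield L)) L (IsCMField.complexConj L) 2).quotFun (truncation ν 𝓕 T (Ec w')) := by
    intro D₁ hD₁o hD₁
    have hDP : ∀ z ∈ D₁, z ∉ P := fun z hz => (hD₁ hz).2
    refine exists_truncatedFamily_levelChange L μ ν 𝓕 (hT₀ n hn₀) hT φ Ec hE1 w (fun z hz => hwB z (hDP z hz)) (fun z hz => hwc z (hDP z hz))
      (fun g _ _ => (hwd g).mono fun z hz => hDP z hz) (fun z₀ hz₀ => ?_) (fun z hz hz1 g _ _ => hCT z (hDP z hz) hz1 g) (Fam n) ((hFd n hn₀).mono hD₁)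
      (fun z hz hz1 => hFtube n hn₀ z (hD₁ hz) hz1)
    obtain ⟨r, hr, -, M, hM⟩ := hwloc z₀ (hDP z₀ hz₀) (min (T₀ n) T) (max (T₀ n) T) (le_min (hT₀ n hn₀) hT)
    obtain ⟨r₁, hr₁, hr₁D⟩ := Metric.isOpen_iff.1 hD₁o z₀ hz₀
    exact ⟨min r r₁, lt_min hr hr₁, (Metric.ball_subset_ball (min_le_right _ _)).trans hr₁D, M,
      fun z hz g h1 h2 => hM z (Metric.ball_subset_ball (min_le_left _ _) hz) g h1 h2⟩
  rcases lt_or_gt_of_ne hzim with hneg | hpos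
  · -- the lower quadrant
    obtain ⟨hD₁o, hD₁c, O₁, O₂', hO₁, hO₁ne, hO₁D, hO₂', hO₂'ne, hO₂'D, hsep⟩ := lowerDomain_topology n hn2 (hUo n hn₀) (hUcod n hn₀) hPc hPcount
    have hsub : (({z : ℂ | 1 / 2 < z.re ∧ z.im < 0} ∩ Metric.ball (0 : ℂ) (n + 2) ∩ U n) \ P) ⊆ U n \ P := fun x hx => ⟨hx.1.2, hx.2⟩
    obtain ⟨Fam', hFd', hFt'⟩ := hLC _ hD₁o hsub
    exact ⟨_, O₁, O₂', Fam', hD₁o, hD₁c, Or.inr (fun x hx => hx.1.1.1), hO₁, hO₁ne, hO₁D, hO₂', hO₂'ne, hO₂'D, hsep, ⟨⟨⟨⟨hz₁, hneg⟩, hzn⟩, hzU⟩, hzP⟩,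
      fun x hx => hx.2, hFd', hFt'⟩
  · -- the upper quadrant
    obtain ⟨hD₁o, hD₁c, O₁, O₂', hO₁, hO₁ne, hO₁D, hO₂', hO₂'ne, hO₂'D, hsep⟩ := upperDomain_topology n hn2 (hUo n hn₀) (hUcod n hn₀) hPc hPcount
    have hsub : (({z : ℂ | 1 / 2 < z.re ∧ 0 < z.im} ∩ Metric.ball (0 : ℂ) (n + 2) ∩ U n) \ P) ⊆ U n \ P := fun x hx => ⟨hx.1.2, hx.2⟩
    obtain ⟨Fam', hFd', hFt'⟩ := hLC _ hD₁o hsub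
    exact ⟨_, O₁, O₂', Fam', hD₁o, hD₁c, Or.inl (fun x hx => hx.1.1.1), hO₁, hO₁ne, hO₁D, hO₂', hO₂'ne, hO₂'D, hsep, ⟨⟨⟨⟨hz₁, hpos⟩, hzn⟩, hzU⟩, hzP⟩,
      fun x hx => hx.2, hFd', hFt'⟩

end CM

/-! ## §3 The bad set is countable and the good points are dense in the half-strip -/

/-- **THE BAD SET `P ∪ ⋃_{n ≥ n₀} (D_n ∖ U n)` IS COUNTABLE** (`P` countable, each `D_n ∖ U n` countable by co-discreteness ★ `countable_ball_diff_of_codiscrete`). [folklore] -/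
theorem countable_bad {P : Set ℂ} (hPcount : P.Countable) (n₀ : ℕ) (U : ℕ → Set ℂ)
    (hUcod : ∀ n, n₀ ≤ n → ∀ z₀ ∈ Metric.ball (0 : ℂ) (n + 2), ∀ᶠ s in 𝓝[≠] z₀, s ∈ U n) :
    (P ∪ ⋃ n : {n : ℕ // n₀ ≤ n}, (Metric.ball (0 : ℂ) ((n : ℕ) + 2) \ U n)).Countable :=
  hPcount.union (Set.countable_iUnion fun n => countable_ball_diff_of_codiscrete (hUcod n n.2))

/-- **OFF THE BAD SET EVERY POINT HAS A GOOD BALL**: `z ∉ P ∪ ⋃_{n ≥ n₀} (D_n ∖ U n)` ⟹ `z ∉ P` and `z ∈ U n` for the ball `n = max (max n₀ 2) ⌈‖z‖⌉₊ ∋ z`. [folklore] -/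
theorem exists_good_ball {P : Set ℂ} (n₀ : ℕ) (U : ℕ → Set ℂ) {z : ℂ}
    (hz : z ∉ P ∪ ⋃ n : {n : ℕ // n₀ ≤ n}, (Metric.ball (0 : ℂ) ((n : ℕ) + 2) \ U n)) :
    z ∉ P ∧ ∃ n : ℕ, n₀ ≤ n ∧ 2 ≤ n ∧ z ∈ Metric.ball (0 : ℂ) (n + 2) ∧ z ∈ U n := by
  rw [Set.mem_union, not_or, Set.mem_iUnion, not_exists] at hz
  obtain ⟨hzP, hzU⟩ := hz
  set n : ℕ := max (max n₀ 2) ⌈‖z‖⌉₊ with hn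
  have hn₀ : n₀ ≤ n := (le_max_left _ _).trans (le_max_left _ _)
  have hball : z ∈ Metric.ball (0 : ℂ) (n + 2) := by
    rw [mem_ball_zero_iff]
    have h1 : ‖z‖ ≤ (⌈‖z‖⌉₊ : ℝ) := Nat.le_ceil _
    have h2 : (⌈‖z‖⌉₊ : ℝ) ≤ n := by exact_mod_cast le_max_right (max n₀ 2) ⌈‖z‖⌉₊
    linarith
  refine ⟨hzP, n, hn₀, (le_max_right _ _).trans (le_max_left _ _), hball, ?_⟩
  by_contra hU
  exact hzU ⟨n, hn₀⟩ ⟨hball, hU⟩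

/-- **EVERY POINT OF THE HALF-STRIP `{½ < Re ≤ σ₀, 1 ≤ |Im|}` IS A LIMIT OF HALF-STRIP POINTS AVOIDING A COUNTABLE SET** (along the segment `z + δ(−1 + sign(Im z)·i)`, which stays in the
half-strip; a countable set is Lebesgue-null on each interval of `δ`'s). [folklore] -/
theorem exists_seq_tendsto_of_countable {S : Set ℂ} (hS : S.Countable) {σ₀ : ℝ} {z : ℂ} (hz₁ : 1 / 2 < z.re) (hz₂ : z.re ≤ σ₀) (ht : 1 ≤ |z.im|) :
    ∃ u : ℕ → ℂ, (∀ k, 1 / 2 < (u k).re ∧ (u k).re ≤ σ₀ ∧ 1 ≤ |(u k).im| ∧ u k ∉ S) ∧ Tendsto u atTop (𝓝 z) := by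
  classical
  -- direction: real part decreases, imaginary part moves away from the axis
  set sgn : ℝ := if 0 ≤ z.im then 1 else -1 with hsgn
  set v : ℂ := ⟨-1, sgn⟩ with hv
  have hv0 : v ≠ 0 := fun h => by have := congrArg Complex.re h; simp [hv] at this
  -- the line `δ ↦ z + δ v` meets `S` in a countable set of parameters
  have hinj : Function.Injective fun δ : ℝ => z + (δ : ℂ) * v := by
    intro a b hab
    have h := mul_right_cancel₀ hv0 (add_left_cancel hab)
    exact_mod_cast h
  have hcount : ((fun δ : ℝ => z + (δ : ℂ) * v) ⁻¹' S).Countable := hS.preimage_of_injOn hinj.injOn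
  -- in every interval `(0, ε)` there is a good parameter
  have hgood : ∀ ε : ℝ, 0 < ε → ∃ δ : ℝ, 0 < δ ∧ δ < ε ∧ z + (δ : ℂ) * v ∉ S := by
    intro ε hε
    by_contra h
    push Not at h
    have hsub : Set.Ioo (0 : ℝ) ε ⊆ (fun δ : ℝ => z + (δ : ℂ) * v) ⁻¹' S := fun δ hδ => h δ hδ.1 hδ.2
    have h0 : volume (Set.Ioo (0 : ℝ) ε) = 0 := measure_mono_null hsub (hcount.measure_zero volume)
    rw [Real.volume_Ioo, sub_zero, ENNReal.ofReal_eq_zero] at h0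
    linarith
  have hε : ∀ k : ℕ, 0 < min (z.re - 1 / 2) (1 / ((k : ℝ) + 1)) := fun k => lt_min (by linarith) (by positivity)
  choose δ hδ using fun k : ℕ => hgood _ (hε k)
  refine ⟨fun k => z + (δ k : ℂ) * v, fun k => ?_, ?_⟩
  · obtain ⟨hδ0, hδε, hδS⟩ := hδ k
    have hδ1 : δ k < z.re - 1 / 2 := hδε.trans_le (min_le_left _ _)
    have hre : (z + (δ k : ℂ) * v).re = z.re - δ k := by simp [hv]; ring
    have him : (z + (δ k : ℂ) * v).im = z.im + δ k * sgn := by simp [hv]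
    refine ⟨by rw [hre]; linarith, by rw [hre]; linarith, ?_, hδS⟩
    rw [him, hsgn]
    split_ifs with h0
    · rw [abs_of_nonneg h0] at ht
      rw [mul_one, abs_of_nonneg (by linarith)]; linarith
    · push Not at h0
      rw [abs_of_neg h0] at ht
      rw [mul_neg, mul_one, abs_of_neg (by linarith)]; linarith
  · have hδ0 : Tendsto δ atTop (𝓝 0) := by
      refine squeeze_zero (fun k => (hδ k).1.le) (fun k => ((hδ k).2.1.le.trans (min_le_right _ _))) ?_
      exact tendsto_one_div_add_atTop_nhds_zero_nat
    have h := ((Complex.continuous_ofReal.tendsto 0).comp hδ0).mul_const v |>.const_add z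
    simpa using h


end Summit.HodgeConjecture.HodgeConjecture.Cruxes.H413.K2E1ChiEisensteinPerPointFamilyCMTwo

end
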